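import Literature.Geometry.Kaehler.ComplexTorusAnalyticClassesWeilType
import Mathlib.Algebra.Group.ForwardDiff
import HarnessLib

/-!
# The analytic classes are an `End_ℚ(X)`-submodule of `H^{2p}(X, ℚ)`: `u^* Aᵖ(X) ⊆ Aᵖ(X)` for EVERY
# rational endomorphism `u` of a complex torus

Layer `Literature/Geometry/Kaehler`, namespace `Literature.Geometry.Kaehler.ComplexTorus`; lane
`lit-hodgefound`, seat p07 (generation 35). Theorems only (no `def`, no named fact, no instance, no notation).

The tree has `f^* Aᵖ(X') ⊆ Aᵖ(X)` for an ISOGENY `f` (`IsIsogeny.comp_realRep_mem_analyticClasses`: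
`f^*[Z'] = ± [f⁻¹ Z']`, Fulton §1.7) and, from it, for every INVERTIBLE element of `End_ℚ(X)`
(`compContinuousLinearMap_analyticRepReal_mem_analyticClasses_of_isUnit`, file
`ComplexTorusAnalyticClassesWeilType`). Here: **for every `u ∈ End_ℚ(X)` — invertible or not: a projector,
a nilpotent, `0` — the pull-back `u^*` on `H^{2p}(X, ℂ) = Alt^{2p}_ℝ(V; ℂ)` maps `Aᵖ(X)` into `Aᵖ(X)`**
(`compContinuousLinearMap_analyticRepReal_mem_analyticClasses`), i.e. `Aᵖ(X) ⊆ H^{2p}(X, ℚ)` is a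
sub-`End_ℚ(X)`-module for the action "using the maps `f^*` … the algebra `End(X)_ℚ` acts on `H¹(X, ℚ)`"
(van Geemen 4.8) extended multiplicatively to `H^{2p} = ⋀^{2p} H¹`; classically this is the action of the
graph correspondence `Γ_u` on algebraic cycles (Fulton, Ch. 16). The proof avoids correspondences and moving
lemmas:

* §1 (multilinear algebra) **`k! · γ ∘ T^{⊗k} = Σ_{i=0}^{k} (-1)^{k-i} C(k,i) · γ ∘ ((m₀ + i)T + 1)^{⊗k}`**
  for every real operator `T`, every `k`-form `γ` and every `m₀ ∈ ℕ` (private lemmas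
  `factorial_mul_apply_eq_sum`, `factorial_smul_compContinuousLinearMap_eq_sum`): `μ ↦ γ ∘ (μT + 1)^{⊗k}` is a polynomial of degree
  `≤ k` in `μ` with `μ^k`-coefficient `γ ∘ T^{⊗k}` (multilinear expansion), and the `k`-th forward
  difference of such a polynomial is `k!` times that coefficient (Mathlib's `fwdDiff_iter_eq_factorial`,
  Newton's formula `fwdDiff_iter_eq_sum_shift`).
* §2 (matrices) `mβ + 1` is invertible for all natural `m ≥ m₀(β)` (private `exists_forall_isUnit_natCast_smul_add_one`:
  `det(Xβ + 1) ∈ ℚ[X]` has constant term `1`, hence finitely many roots).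
* §3 (torus) **`β^* Aᵖ(X) ⊆ Aᵖ(X)` for every `β ∈ End_ℚ(X)`**: the right-hand side of §1 with
  `T = ρ(β)` consists of pull-backs along the invertible endomorphisms `(m₀ + i) + β`; `Aᵖ(X)` is a
  `ℚ`-subspace and `k! ≠ 0`. Corollaries: integral endomorphisms `ρ(A)`, `A_ℚ ∈ End_ℚ(X)`, with no
  isogeny hypothesis (`comp_realRep_mem_analyticClasses_of_mem_endAlgRat`); idempotents
  (`compContinuousLinearMap_analyticRepReal_one_sub_mem_analyticClasses`).

## References

* [vanGeemen1994HodgeAV] B. van Geemen, *An introduction to the Hodge conjecture for abelian varieties*, LNM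
  1594 (1994), 4.8–4.9.
* [Fulton1998] W. Fulton, *Intersection Theory*, 2nd ed. (1998), §1.7; Ch. 16 (correspondences), §16.1.
* [Lange2023AbelianVarietiesComplex] H. Lange, *Abelian Varieties over the Complex Numbers* (2023), §1.1.2
  Prop. 1.1.6 and Cor. 1.1.16 (b); §7.3.3 Exercise (1) (p. 341).
-/

noncomputable section

open scoped Manifold
open Module Set Function

universe u

namespace Literature.Geometry.Kaehler

namespace ComplexTorus

/-! ### §1 The finite-difference identity for pull-backs of a `k`-form -/

section FiniteDifference

variable {E : Type*} [NormedAddCommGroup E] [NormedSpace ℂ E]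

/-- Scaling the `s`-slots of `s.piecewise a b` scales the value of a `k`-form by `μ^{|s|}`. [folklore] -/
private theorem apply_piecewise_smul {k : ℕ} (γ : E [⋀^Fin k]→L[ℝ] ℂ) (s : Finset (Fin k)) (μ : ℝ)
    (a b : Fin k → E) :
    γ (s.piecewise (fun j ↦ μ • a j) b) = ((μ : ℂ) ^ s.card) * γ (s.piecewise a b) := by
  classical
  have hre : s.piecewise (fun j ↦ μ • a j) b =
      s.piecewise (fun j ↦ μ • (s.piecewise a b) j) (s.piecewise a b) := by
    funext j
    by_cases hj : j ∈ s
    · rw [Finset.piecewise_eq_of_mem _ _ _ hj, Finset.piecewise_eq_of_mem _ _ _ hj,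
        Finset.piecewise_eq_of_mem _ _ _ hj]
    · rw [Finset.piecewise_eq_of_notMem _ _ _ hj, Finset.piecewise_eq_of_notMem _ _ _ hj,
        Finset.piecewise_eq_of_notMem _ _ _ hj]
  rw [hre, γ.map_piecewise_smul (fun _ ↦ μ) (s.piecewise a b) s, Finset.prod_const, Complex.real_smul,
    Complex.ofReal_pow]

/-- **Multilinear expansion: `γ((μT + 1)v) = Σ_s μ^{|s|} γ(s.piecewise (Tv) v)`** (real `μ`). [folklore] -/
private theorem apply_smul_add_eq_sum {k : ℕ} (γ : E [⋀^Fin k]→L[ℝ] ℂ) (T : E →L[ℝ] E) (v : Fin k → E)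
    (μ : ℝ) :
    γ (fun j ↦ μ • T (v j) + v j) =
      ∑ s : Finset (Fin k), ((μ : ℂ) ^ s.card) * γ (s.piecewise (fun j ↦ T (v j)) v) := by
  classical
  have h := γ.map_add_univ (fun j ↦ μ • T (v j)) v
  have hfun : ((fun j ↦ μ • T (v j)) + v) = fun j ↦ μ • T (v j) + v j := rfl
  rw [hfun] at h
  rw [h]
  exact Finset.sum_congr rfl fun s _ ↦ apply_piecewise_smul γ s μ _ v

/-- **`k! · γ(Tv) = Σ_{i=0}^{k} (-1)^{k-i} C(k,i) · γ(((m₀ + i)T + 1)v)`** for every `k`-form `γ`, real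
operator `T`, `v ∈ V^k` and `m₀ ∈ ℕ`: the `k`-th forward difference at `m₀` of the polynomial
`μ ↦ γ((μT + 1)v)` of degree `≤ k`, whose `μ^k`-coefficient is `γ(Tv)` (Newton's forward-difference
formula). [folklore] -/
private theorem factorial_mul_apply_eq_sum {k : ℕ} (γ : E [⋀^Fin k]→L[ℝ] ℂ) (T : E →L[ℝ] E) (v : Fin k → E)
    (m₀ : ℕ) :
    (k.factorial : ℂ) * γ (fun j ↦ T (v j)) =
      ∑ i ∈ Finset.range (k + 1), (((-1 : ℤ) ^ (k - i) * k.choose i : ℤ) : ℂ) *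
        γ (fun j ↦ ((m₀ + i : ℕ) : ℝ) • T (v j) + v j) := by
  classical
  -- the polynomial function `g(z) = Σ_s c_s z^{|s|}` on `ℂ`, `c_s = γ(s.piecewise (Tv) v)`
  set c : Finset (Fin k) → ℂ := fun s ↦ γ (s.piecewise (fun j ↦ T (v j)) v) with hc
  set g : ℂ → ℂ := fun z ↦ ∑ s : Finset (Fin k), c s * z ^ s.card with hg
  have hg_real : ∀ μ : ℝ, g μ = γ (fun j ↦ μ • T (v j) + v j) := fun μ ↦ by
    rw [hg, apply_smul_add_eq_sum]
    exact Finset.sum_congr rfl fun s _ ↦ mul_comm _ _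
  have hg_eq : g = ∑ s : Finset (Fin k), c s • (fun z : ℂ ↦ z ^ s.card) := by
    funext z
    rw [hg, Finset.sum_apply]
    simp only [Pi.smul_apply, smul_eq_mul]
  -- `Δ^k g (m₀) = k! · c_univ = k! · γ(Tv)`
  have hΔ : (fwdDiff (1 : ℂ))^[k] g (m₀ : ℂ) = (k.factorial : ℂ) * γ (fun j ↦ T (v j)) := by
    rw [hg_eq, fwdDiff_iter_finsetSum, Finset.sum_apply,
      Finset.sum_eq_single (Finset.univ : Finset (Fin k))]
    · rw [fwdDiff_iter_const_smul, Finset.card_univ, Fintype.card_fin, fwdDiff_iter_eq_factorial, Pi.smul_apply,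
        Pi.natCast_apply, smul_eq_mul, mul_comm, hc]
      simp only [Finset.piecewise_univ]
    · intro s _ hs
      have hlt : s.card < k := by simpa using (Finset.card_lt_iff_ne_univ s).2 hs
      rw [fwdDiff_iter_const_smul, fwdDiff_iter_pow_eq_zero_of_lt hlt, smul_zero, Pi.zero_apply]
    · intro h
      exact absurd (Finset.mem_univ _) h
  -- Newton's formula `Δ^k g (m₀) = Σ_i (-1)^{k-i} C(k,i) g(m₀ + i)`
  have hN := fwdDiff_iter_eq_sum_shift (1 : ℂ) g k (m₀ : ℂ)
  rw [hΔ] at hN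
  rw [hN]
  refine Finset.sum_congr rfl fun i _ ↦ ?_
  rw [zsmul_eq_mul, nsmul_eq_mul, mul_one]
  congr 1
  have hcast : ((m₀ : ℂ) + (i : ℂ)) = (((m₀ + i : ℕ) : ℝ) : ℂ) := by push_cast; ring
  rw [hcast, hg_real]

/-- **`k! · γ ∘ T^{⊗k} = Σ_{i=0}^{k} (-1)^{k-i} C(k,i) · γ ∘ ((m₀ + i)T + 1)^{⊗k}`** as an identity of
`k`-forms. [folklore] -/
private theorem factorial_smul_compContinuousLinearMap_eq_sum {k : ℕ} (γ : E [⋀^Fin k]→L[ℝ] ℂ) (T : E →L[ℝ] E)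
    (m₀ : ℕ) :
    (k.factorial : ℂ) • γ.compContinuousLinearMap T =
      ∑ i ∈ Finset.range (k + 1), (((-1 : ℤ) ^ (k - i) * k.choose i : ℤ) : ℂ) •
        γ.compContinuousLinearMap (((m₀ + i : ℕ) : ℝ) • T + ContinuousLinearMap.id ℝ E) := by
  ext v
  rw [ContinuousAlternatingMap.smul_apply, ContinuousAlternatingMap.compContinuousLinearMap_apply, smul_eq_mul,
    ContinuousAlternatingMap.sum_apply]
  have h := factorial_mul_apply_eq_sum γ T v m₀
  refine h.trans (Finset.sum_congr rfl fun i _ ↦ ?_)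
  rw [ContinuousAlternatingMap.smul_apply, ContinuousAlternatingMap.compContinuousLinearMap_apply, smul_eq_mul]
  rfl

end FiniteDifference

/-! ### §2 `mβ + 1` is invertible for all large natural `m` -/

section GenericUnit

variable {ι : Type*} [Fintype ι] [DecidableEq ι]

/-- `eval_q det(Xβ + 1) = det(qβ + 1)`. [folklore] -/
private theorem eval_det_X_smul_add_one (β : Matrix ι ι ℚ) (q : ℚ) :
    (((Polynomial.X : Polynomial ℚ) • β.map Polynomial.C + 1).det).eval q = (q • β + 1).det := by
  have h1 := RingHom.map_det (Polynomial.evalRingHom q) ((Polynomial.X : Polynomial ℚ) • β.map Polynomial.C + 1)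
  rw [Polynomial.coe_evalRingHom] at h1
  rw [h1]
  congr 1
  ext i j
  rw [RingHom.mapMatrix_apply, Matrix.map_apply, Matrix.add_apply, Matrix.add_apply, Matrix.smul_apply,
    Matrix.smul_apply, Matrix.map_apply, map_add, smul_eq_mul, smul_eq_mul, map_mul, Polynomial.coe_evalRingHom,
    Polynomial.eval_X, Polynomial.eval_C, Matrix.one_apply, Matrix.one_apply]
  split_ifs <;> simp

/-- **For a rational square matrix `β`, `mβ + 1` is invertible for every natural `m ≥ m₀(β)`**: the
polynomial `det(Xβ + 1) ∈ ℚ[X]` takes the value `1` at `0`, so it is non-zero and has finitely many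
(natural) roots. [folklore] -/
private theorem exists_forall_isUnit_natCast_smul_add_one (β : Matrix ι ι ℚ) :
    ∃ m₀ : ℕ, ∀ m : ℕ, m₀ ≤ m → IsUnit ((m : ℚ) • β + 1) := by
  classical
  set P : Polynomial ℚ := ((Polynomial.X : Polynomial ℚ) • β.map Polynomial.C + 1).det with hP
  have hP0 : P ≠ 0 := by
    intro h0
    have h := eval_det_X_smul_add_one β 0
    rw [← hP, h0, Polynomial.eval_zero, zero_smul, zero_add, Matrix.det_one] at h
    exact zero_ne_one h
  have hfin : Set.Finite {m : ℕ | P.IsRoot (m : ℚ)} :=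
    (Polynomial.finite_setOf_isRoot hP0).preimage Nat.cast_injective.injOn
  obtain ⟨N, hN⟩ := hfin.bddAbove
  refine ⟨N + 1, fun m hm ↦ ?_⟩
  have hne : (((m : ℚ)) • β + 1).det ≠ 0 := by
    intro h0
    have hroot : m ∈ {m : ℕ | P.IsRoot (m : ℚ)} := by
      change P.eval (m : ℚ) = 0
      rw [hP, eval_det_X_smul_add_one, h0]
    have := hN hroot
    omega
  exact (Matrix.isUnit_iff_isUnit_det _).2 (isUnit_iff_ne_zero.2 hne)

end GenericUnit

/-! ### §3 `u^* Aᵖ(X) ⊆ Aᵖ(X)` for every `u ∈ End_ℚ(X)` -/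

section Endomorphisms

variable {ι : Type*} [Fintype ι] [DecidableEq ι] {E : Type u} [NormedAddCommGroup E] [InnerProductSpace ℂ E]
  [FiniteDimensional ℂ E] [MeasurableSpace E] [BorelSpace E] (Φ : (ι → ℝ) ≃L[ℝ] E) {N : ℕ} (e : Fin N ≃ ι)

omit [FiniteDimensional ℂ E] [MeasurableSpace E] [BorelSpace E] in
/-- `ρ(mβ + 1) = m ρ(β) + id`. [cite: Lange2023AbelianVarietiesComplex, §1.1.2 Prop. 1.1.6] -/
private theorem analyticRepReal_natCast_smul_add_one (β : Matrix ι ι ℚ) (m : ℕ) :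
    analyticRepReal Φ Φ ((((m : ℚ)) • β + 1).map (Rat.cast : ℚ → ℝ)) =
      ((m : ℕ) : ℝ) • analyticRepReal Φ Φ (β.map (Rat.cast : ℚ → ℝ)) + ContinuousLinearMap.id ℝ E := by
  have hmap : (((m : ℚ)) • β + 1).map (Rat.cast : ℚ → ℝ) = ((m : ℝ)) • β.map (Rat.cast : ℚ → ℝ) + 1 := by
    ext i j
    simp [Matrix.one_apply, apply_ite (Rat.cast : ℚ → ℝ)]
  rw [hmap, analyticRepReal_add, analyticRepReal_smul, analyticRepReal_one]

/-- **`Aᵖ(X)` is an `End_ℚ(X)`-submodule of `H^{2p}(X, ℚ)`: `u^* Aᵖ(X) ⊆ Aᵖ(X)` for EVERY `u ∈ End_ℚ(X)`**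
(rational matrix `β ∈ End_ℚ(X)`, pull-back along its real analytic representation `ρ(β)`; no invertibility
assumed). Proof: `(2p)! · β^*γ = Σ_i (-1)^{2p-i} C(2p, i) · (m₀ + i + β)^*γ` (§1) with all `m₀ + i + β`
invertible in `End_ℚ(X)` (§2), each term analytic (`…_of_isUnit`), and `Aᵖ(X)` is a `ℚ`-subspace.
[cite: vanGeemen1994HodgeAV, 4.8–4.9 (`End(X)_ℚ` acts on `H^•(X, ℚ)` via `f^*`)] [cite: Fulton1998, §1.7 and §16.1]
[cite: Lange2023AbelianVarietiesComplex, §1.1.2 Cor. 1.1.16 (b)] -/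
theorem compContinuousLinearMap_analyticRepReal_mem_analyticClasses {β : Matrix ι ι ℚ}
    (hβ : β ∈ endAlgRat Φ) {p : ℕ} {γ : E [⋀^Fin (2 * p)]→L[ℝ] ℂ} (hγ : γ ∈ analyticClasses Φ e p) :
    γ.compContinuousLinearMap (analyticRepReal Φ Φ (β.map (Rat.cast : ℚ → ℝ))) ∈ analyticClasses Φ e p := by
  obtain ⟨m₀, hm₀⟩ := exists_forall_isUnit_natCast_smul_add_one β
  have hsum := factorial_smul_compContinuousLinearMap_eq_sum γ (analyticRepReal Φ Φ (β.map (Rat.cast : ℚ → ℝ))) m₀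
  -- every term of the sum is analytic
  have hterm : ∀ i ∈ Finset.range (2 * p + 1), (((-1 : ℤ) ^ (2 * p - i) * (2 * p).choose i : ℤ) : ℂ) •
      γ.compContinuousLinearMap (((m₀ + i : ℕ) : ℝ) • analyticRepReal Φ Φ (β.map (Rat.cast : ℚ → ℝ)) +
        ContinuousLinearMap.id ℝ E) ∈ analyticClasses Φ e p := by
    intro i _
    rw [← analyticRepReal_natCast_smul_add_one Φ β (m₀ + i)]
    have hz : ((((-1 : ℤ) ^ (2 * p - i) * (2 * p).choose i : ℤ)) : ℂ) =
        (((((-1 : ℤ) ^ (2 * p - i) * (2 * p).choose i : ℤ)) : ℚ) : ℂ) := (Rat.cast_intCast _).symm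
    rw [hz, Rat.cast_smul_eq_qsmul]
    refine Submodule.smul_mem _ _ ?_
    exact compContinuousLinearMap_analyticRepReal_mem_analyticClasses_of_isUnit Φ e
      (add_mem ((endAlgRat Φ).smul_mem hβ _) (one_mem _)) (hm₀ (m₀ + i) (Nat.le_add_right _ _)) hγ
  have hmem : ((2 * p).factorial : ℂ) • γ.compContinuousLinearMap (analyticRepReal Φ Φ (β.map (Rat.cast : ℚ → ℝ))) ∈
      analyticClasses Φ e p := by
    rw [hsum]
    exact Submodule.sum_mem _ hterm
  have hq : (((2 * p).factorial : ℂ)) = ((((2 * p).factorial : ℕ) : ℚ) : ℂ) := by push_cast; rfl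
  rw [hq, Rat.cast_smul_eq_qsmul] at hmem
  have hne : (((2 * p).factorial : ℕ) : ℚ) ≠ 0 := Nat.cast_ne_zero.2 (Nat.factorial_ne_zero _)
  have h2 := (analyticClasses Φ e p).smul_mem ((((2 * p).factorial : ℕ) : ℚ))⁻¹ hmem
  rwa [smul_smul, inv_mul_cancel₀ hne, one_smul] at h2

/-- **Integral endomorphisms: `ρ(A)^* Aᵖ(X) ⊆ Aᵖ(X)` for every `A ∈ End(X)`** (integer matrix with
`ℂ`-linear analytic representation, i.e. `A_ℚ ∈ End_ℚ(X)`; no isogeny hypothesis — compare the tree's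
`IsIsogeny.comp_realRep_mem_analyticClasses`). [cite: vanGeemen1994HodgeAV, 4.8–4.9] [cite: Fulton1998, §16.1] -/
theorem comp_realRep_mem_analyticClasses_of_mem_endAlgRat {A : Matrix ι ι ℤ}
    (hA : A.map (Int.cast : ℤ → ℚ) ∈ endAlgRat Φ) {p : ℕ} {γ : E [⋀^Fin (2 * p)]→L[ℝ] ℂ}
    (hγ : γ ∈ analyticClasses Φ e p) : γ.compContinuousLinearMap (realRep Φ Φ A) ∈ analyticClasses Φ e p := by
  have hmap : A.map (Int.cast : ℤ → ℝ) = (A.map (Int.cast : ℤ → ℚ)).map (Rat.cast : ℚ → ℝ) := by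
    ext i j
    simp
  rw [realRep_eq_analyticRepReal, hmap]
  exact compContinuousLinearMap_analyticRepReal_mem_analyticClasses Φ e hA hγ

/-- **Idempotents of `End_ℚ(X)` split the analytic classes**: for `ε ∈ End_ℚ(X)`, both `ε^*γ` and
`(1 - ε)^*γ` are analytic for analytic `γ` (the pieces of `Aᵖ(X)` under a decomposition of `X` up to isogeny,
`X ∼ ε X × (1-ε) X`, Poincaré reducibility). [cite: vanGeemen1994HodgeAV, 4.8–4.9]
[cite: Lange2023AbelianVarietiesComplex, §1.1.2 Prop. 1.1.6] -/
theorem compContinuousLinearMap_analyticRepReal_one_sub_mem_analyticClasses {ε : Matrix ι ι ℚ}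
    (hε : ε ∈ endAlgRat Φ) {p : ℕ} {γ : E [⋀^Fin (2 * p)]→L[ℝ] ℂ} (hγ : γ ∈ analyticClasses Φ e p) :
    γ.compContinuousLinearMap (analyticRepReal Φ Φ (ε.map (Rat.cast : ℚ → ℝ))) ∈ analyticClasses Φ e p ∧
      γ.compContinuousLinearMap (analyticRepReal Φ Φ ((1 - ε).map (Rat.cast : ℚ → ℝ))) ∈ analyticClasses Φ e p :=
  ⟨compContinuousLinearMap_analyticRepReal_mem_analyticClasses Φ e hε hγ,
    compContinuousLinearMap_analyticRepReal_mem_analyticClasses Φ e (sub_mem (one_mem _) hε) hγ⟩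

end Endomorphisms

end ComplexTorus

end Literature.Geometry.Kaehler

end
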